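import Literature.Geometry.Lorentzian.Basic
import Literature.Analysis.Calculus.HardyExteriorDecay

/-!
# Route ClusterCompleteness — crux `AdiabaticMultiKerrILED`, line `Sketch`: the Hardy
# inequality on the exterior of a ball (stub `leaf_hardy_exterior`)

Helper file for the crux `stmt-FinalStateConjecture-14310`
(`Summit.FinalStateConjecture.FinalStateConjecture.Theses.ClusterCompleteness.AdiabaticMultiKerrILED`),
closing the stub `leaf_hardy_exterior` of line `Sketch`: for `M > 0` and `u : E3 → ℝ` of class
`C¹` on the open exterior `{‖y‖ > 2M}` with `∫_{‖y‖ > ρ₀} u²/‖y‖² < ∞` for some `ρ₀` (Hardy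
decay), `∫_{‖y‖ > 2M} u²/‖y‖² ≤ C ∫_{‖y‖ > 2M} ‖Du‖²` with `C = 4` (the sharp constant
`(2/(n − 2))²` of dimension `n = 3`). For the zero-spin leaves of the Morawetz estimate the
Kerr–Schild radius is `‖y‖`, so this bounds the zeroth-order leaf term by the leaf energy.

Proof. For every `r > 2M` the integral `∫_{‖y‖ > r} u²/‖y‖²` is finite
(`leaf_hardy_exterior_finite`: the integrand is bounded on the compact annulus
`{r ≤ ‖y‖ ≤ max ρ₀ r}`, on which `u` is continuous, and the decay hypothesis controls the rest),
so the exterior Hardy inequality under an integrability hypothesis,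
`Literature.Analysis.Calculus.hardy_sq_lintegral_exterior_le_of_integrable` (which needs `u` of
class `C¹` on `{‖y‖ > R₀}` for some `R₀ < r` only — here `R₀ = 2M`), gives
`∫_{‖y‖ > r} u²/‖y‖² ≤ 4 ∫_{‖y‖ > r} ‖Du‖² ≤ 4 ∫_{‖y‖ > 2M} ‖Du‖²`; finally `{‖y‖ > 2M}` is
exhausted by the exteriors `{‖y‖ > 2M + 1/(k+1)}` (monotone convergence,
`setLIntegral_iUnion_of_directed`).

Folklore (Hardy's inequality outside a ball, no boundary term needed since the inner boundary
term has the favourable sign). [folklore]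
-/

noncomputable section

-- the doubled `FinalStateConjecture.FinalStateConjecture` path component trips dupNamespace
set_option linter.dupNamespace false

open Literature.Geometry.Lorentzian Literature.Analysis.Calculus MeasureTheory Set Filter Metric
open scoped Topology ENNReal

namespace Summit.FinalStateConjecture.FinalStateConjecture.Theorems

/-- **Finiteness of the Hardy integral on smaller exteriors.** If `u` is continuous on
`{‖y‖ > R}` and `∫_{‖y‖ > ρ₀} u²/‖y‖² < ∞` for some `ρ₀`, then `∫_{‖y‖ > r} u²/‖y‖² < ∞` for
every `r > max(R, 0)` (bounded integrand on the compact annulus `{r ≤ ‖y‖ ≤ max ρ₀ r}`).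
[folklore] -/
theorem leaf_hardy_exterior_finite {u : E3 → ℝ} {R r : ℝ} (hr : 0 < r) (hRr : R < r)
    (hu : ContinuousOn u {y : E3 | R < ‖y‖})
    (hdec : ∃ ρ₀ : ℝ, ∫⁻ y in {y : E3 | ρ₀ < ‖y‖}, ENNReal.ofReal (u y ^ 2 / ‖y‖ ^ 2) < ⊤) :
    ∫⁻ y in {y : E3 | r < ‖y‖}, ENNReal.ofReal (u y ^ 2 / ‖y‖ ^ 2) < ⊤ := by
  obtain ⟨ρ₀, hρ₀⟩ := hdec
  set R' : ℝ := max ρ₀ r with hR'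
  -- the compact annulus `K = {r ≤ ‖y‖ ≤ R'}`
  set K : Set E3 := closedBall (0 : E3) R' ∩ {y : E3 | r ≤ ‖y‖} with hK
  have hKc : IsCompact K :=
    (isCompact_closedBall (0 : E3) R').inter_right (isClosed_le continuous_const continuous_norm)
  have hKsub : K ⊆ {y : E3 | R < ‖y‖} := fun y hy => hRr.trans_le hy.2
  obtain ⟨C, hC⟩ := hKc.exists_bound_of_continuousOn (hu.mono hKsub)
  have hnear : ∫⁻ y in K, ENNReal.ofReal (u y ^ 2 / ‖y‖ ^ 2) < ⊤ := by
    refine lt_of_le_of_lt (setLIntegral_mono' (μ := volume) hKc.measurableSet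
      (g := fun _ => ENNReal.ofReal (C ^ 2 / r ^ 2)) fun y hy => ?_) ?_
    · refine ENNReal.ofReal_le_ofReal ?_
      have hyr : r ≤ ‖y‖ := hy.2
      have hvy : |u y| ≤ C := by simpa [Real.norm_eq_abs] using hC y hy
      have h1 : u y ^ 2 ≤ C ^ 2 := by
        rw [← sq_abs (u y)]
        exact pow_le_pow_left₀ (abs_nonneg _) hvy 2
      have h2 : r ^ 2 ≤ ‖y‖ ^ 2 := pow_le_pow_left₀ hr.le hyr 2
      calc u y ^ 2 / ‖y‖ ^ 2 ≤ C ^ 2 / ‖y‖ ^ 2 := div_le_div_of_nonneg_right h1 (sq_nonneg _)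
        _ ≤ C ^ 2 / r ^ 2 := div_le_div_of_nonneg_left (sq_nonneg _) (by positivity) h2
    · rw [setLIntegral_const]
      exact ENNReal.mul_lt_top ENNReal.ofReal_lt_top
        ((measure_mono inter_subset_left).trans_lt measure_closedBall_lt_top)
  -- the far part `{R' < ‖y‖}` is controlled by the decay hypothesis
  have hfar : ∫⁻ y in {y : E3 | R' < ‖y‖}, ENNReal.ofReal (u y ^ 2 / ‖y‖ ^ 2) < ⊤ :=
    lt_of_le_of_lt (lintegral_mono_set fun y (hy : R' < ‖y‖) =>
      show ρ₀ < ‖y‖ from (le_max_left _ _).trans_lt hy) hρ₀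
  have hcov : {y : E3 | r < ‖y‖} ⊆ K ∪ {y : E3 | R' < ‖y‖} := by
    intro y hy
    by_cases h : ‖y‖ ≤ R'
    · exact Or.inl ⟨mem_closedBall_zero_iff.2 h, show r ≤ ‖y‖ from le_of_lt hy⟩
    · exact Or.inr (lt_of_not_ge h)
  calc ∫⁻ y in {y : E3 | r < ‖y‖}, ENNReal.ofReal (u y ^ 2 / ‖y‖ ^ 2)
      ≤ ∫⁻ y in K ∪ {y : E3 | R' < ‖y‖}, ENNReal.ofReal (u y ^ 2 / ‖y‖ ^ 2) :=
        lintegral_mono_set hcov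
    _ ≤ (∫⁻ y in K, ENNReal.ofReal (u y ^ 2 / ‖y‖ ^ 2)) +
          ∫⁻ y in {y : E3 | R' < ‖y‖}, ENNReal.ofReal (u y ^ 2 / ‖y‖ ^ 2) :=
        lintegral_union_le _ _ _
    _ < ⊤ := ENNReal.add_lt_top.2 ⟨hnear, hfar⟩

/-- **Hardy inequality on a smaller exterior.** If `u` is `C¹` on `{‖y‖ > R}` (`R ≥ 0`) with
Hardy decay, then for every `r > R`,
`∫_{‖y‖ > r} u²/‖y‖² ≤ 4 ∫_{‖y‖ > R} ‖Du‖²` (the exterior Hardy inequality with integrability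
hypothesis of `Literature.Analysis.Calculus.HardyExteriorDecay`, constant `(2/(3 − 2))² = 4`).
[folklore] -/
theorem leaf_hardy_exterior_radius {u : E3 → ℝ} {R r : ℝ} (hR : 0 ≤ R) (hRr : R < r)
    (hu : ∀ y : E3, R < ‖y‖ → ContDiffAt ℝ 1 u y)
    (hdec : ∃ ρ₀ : ℝ, ∫⁻ y in {y : E3 | ρ₀ < ‖y‖}, ENNReal.ofReal (u y ^ 2 / ‖y‖ ^ 2) < ⊤) :
    ∫⁻ y in {y : E3 | r < ‖y‖}, ENNReal.ofReal (u y ^ 2 / ‖y‖ ^ 2) ≤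
      4 * ∫⁻ y in {y : E3 | R < ‖y‖}, ENNReal.ofReal (‖fderiv ℝ u y‖ ^ 2) := by
  have hr : 0 < r := hR.trans_lt hRr
  have finrank_E3 : Module.finrank ℝ E3 = 3 := by simp
  have hcont : ContinuousOn u {y : E3 | R < ‖y‖} := fun y hy =>
    (hu y hy).continuousAt.continuousWithinAt
  have h := hardy_sq_lintegral_exterior_le_of_integrable (R₀ := R) hRr hr hu
    (leaf_hardy_exterior_finite hr hRr hcont hdec) finrank_E3.ge
  have hc : ENNReal.ofReal ((2 / ((Module.finrank ℝ E3 : ℝ) - 2)) ^ 2) = 4 := by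
    rw [finrank_E3]; norm_num
  rw [hc] at h
  refine h.trans ?_
  gcongr 4 * ?_
  exact lintegral_mono_set fun y (hy : r < ‖y‖) => show R < ‖y‖ from hRr.trans hy

/-- **Hardy inequality on the exterior of a ball** (stub `leaf_hardy_exterior` of line `Sketch`
of the crux `AdiabaticMultiKerrILED`): for `M > 0` there is a constant `C` (namely `C = 4`) such
that every `u : E3 → ℝ` of class `C¹` on `{‖y‖ > 2M}` with `∫_{‖y‖ > ρ₀} u²/‖y‖² < ∞` for some
`ρ₀` satisfies `∫_{‖y‖ > 2M} u²/‖y‖² ≤ C ∫_{‖y‖ > 2M} ‖Du‖²` (`ℝ≥0∞`-valued integrals; exhaust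
`{‖y‖ > 2M}` by `{‖y‖ > 2M + 1/(k+1)}` in `leaf_hardy_exterior_radius`). [folklore] -/
theorem leaf_hardy_exterior : ∀ (M : ℝ), 0 < M → ∃ C : NNReal, ∀ (u : E3 → ℝ), (∀ y : E3, 2 * M < ‖y‖ → ContDiffAt ℝ 1 u y) → (∃ ρ₀ : ℝ, ∫⁻ y in {y : E3 | ρ₀ < ‖y‖}, ENNReal.ofReal (u y ^ 2 / ‖y‖ ^ 2) < ⊤) → ∫⁻ y in {y : E3 | 2 * M < ‖y‖}, ENNReal.ofReal (u y ^ 2 / ‖y‖ ^ 2) ≤ (C : ENNReal) * ∫⁻ y in {y : E3 | 2 * M < ‖y‖}, ENNReal.ofReal (‖fderiv ℝ u y‖ ^ 2) := by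
  intro M hM
  refine ⟨4, fun u hu hdec => ?_⟩
  have h2M : 0 ≤ 2 * M := by positivity
  set F : E3 → ℝ≥0∞ := fun y => ENNReal.ofReal (u y ^ 2 / ‖y‖ ^ 2) with hF
  set G : ℝ≥0∞ := ∫⁻ y in {y : E3 | 2 * M < ‖y‖}, ENNReal.ofReal (‖fderiv ℝ u y‖ ^ 2) with hG
  -- the exhaustion `{‖y‖ > 2M} = ⋃_k {‖y‖ > 2M + 1/(k+1)}`
  set S : ℕ → Set E3 := fun k => {y : E3 | 2 * M + ((k : ℝ) + 1)⁻¹ < ‖y‖} with hS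
  have hpos : ∀ k : ℕ, (0 : ℝ) < ((k : ℝ) + 1)⁻¹ := fun k => by positivity
  have hU : (⋃ k, S k) = {y : E3 | 2 * M < ‖y‖} := by
    ext y
    simp only [mem_iUnion, hS, mem_setOf_eq]
    constructor
    · rintro ⟨k, hk⟩
      linarith [hpos k]
    · intro hy
      obtain ⟨k, hk⟩ := exists_nat_one_div_lt (sub_pos.2 hy)
      exact ⟨k, by rw [one_div] at hk; linarith⟩
  have hdir : Directed (· ⊆ ·) S := by
    refine Monotone.directed_le fun k l hkl y hy => ?_
    have hy' : 2 * M + ((k : ℝ) + 1)⁻¹ < ‖y‖ := hy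
    show 2 * M + ((l : ℝ) + 1)⁻¹ < ‖y‖
    have hk1 : (0 : ℝ) < (k : ℝ) + 1 := by positivity
    have : ((l : ℝ) + 1)⁻¹ ≤ ((k : ℝ) + 1)⁻¹ :=
      inv_anti₀ hk1 (by exact_mod_cast Nat.succ_le_succ hkl)
    linarith
  calc ∫⁻ y in {y : E3 | 2 * M < ‖y‖}, F y = ∫⁻ y in ⋃ k, S k, F y := by rw [hU]
    _ = ⨆ k, ∫⁻ y in S k, F y := setLIntegral_iUnion_of_directed F hdir
    _ ≤ 4 * G := iSup_le fun k =>
        leaf_hardy_exterior_radius h2M (lt_add_of_pos_right _ (hpos k)) hu hdec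
    _ = ((4 : NNReal) : ℝ≥0∞) * G := by norm_num

end Summit.FinalStateConjecture.FinalStateConjecture.Theorems

end
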